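import Mathlib

/-!
# The homological twist lemma for compressing discs of Klein bottles — algebraic cores

Solo-informed seat (SmoothPoincare4), by-product line "PS87 Table 1, row (T(1) × ℤ_d, order-4 type)".

TOPOLOGY (markdown proof in the seat's records, `work/s127/twist-homological.md`): let `X` be a
ℤ-homology 4-sphere, `𝕂 ⊂ X` a Klein bottle with normal Euler number `0`, `U ⊂ 𝕂` a two-sided
non-separating curve and `Δ` an embedded disc with `Δ ∩ 𝕂 = ∂Δ = U`.  The regular neighbourhood
`R = N(𝕂 ∪ Δ)` is `N(𝕂)` plus a 2-handle attached along a section `C = λ + nμ` of the rim torus with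
framing `(torus framing) + o`, `o = o(Δ)` the twist of the disc.  Because the rim-torus bundle of a
Klein bottle with `e = 0` has monodromy `-I`, the first homology of `∂R` is
`ℤ ⊕ coker M(o)` with the relation matrix `M(o) = !![0, 2; 2o, 1]` (generators `μ₀, C₀`; relations
`2 C₀ = 0` and `C₀ + 2o μ₀ = 0`).  `SoloInformed_twist_smith` puts `M(o)` in Smith form
`diag(1, -4o)` by explicit unimodular matrices, so `tors H₁(∂R) ≅ ℤ/4|o|` is CYCLIC, and vanishes iff
`o = 0`.  An independent Kirby-calculus derivation gives the linking block `!![0,2,1; 2,0,n; 1,n,f]`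
of determinant `4(n-f)` (`SoloInformed_twist_kirby_det`).  A closed 3-manifold embedded in a
ℤ-homology 4-sphere has `tors H₁ ≅ G ⊕ G` (Hantzsche 1938); `SoloInformed_not_addCyclic_double`
shows a direct double `G × G` of a non-trivial finite abelian group is never cyclic.  Hence `o(Δ) = 0`:
every compressing disc of an `e = 0` Klein bottle in a homology 4-sphere is a destabilising disc.
For the seat this removes the `[S]` twist-lemma input: the `d = 7` member of the T*-row (slope of
multiplicity one) is thereby unconditional; for the other members the row theorem still uses the
boundary-parallel tube arc, obtained from `π₁(S⁴_w ∖ Σ₂′) ≅ ℤ` (seat records (xi)(6)), which is NOT a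
consequence of the Klein-bottle group being `ℤ/2` (the double coset of the tube arc is an isotopy
invariant; a stabilisation of the spun trefoil along a knotted arc has group `ℤ/2`).
-/

namespace Summit.SmoothPoincare4.SmoothPoincare4.Theorems

open Matrix

/-- Relation matrix of `H₁(∂N(𝕂 ∪ Δ))` modulo the free summand: rows are the relations
`2 C₀ = 0` and `2o μ₀ + C₀ = 0` in the generators `(μ₀, C₀)`. -/
def SoloInformed_twistRel (o : ℤ) : Matrix (Fin 2) (Fin 2) ℤ := !![0, 2; 2 * o, 1]

/-- Left unimodular matrix of the Smith reduction. -/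
def SoloInformed_twistP : Matrix (Fin 2) (Fin 2) ℤ := !![0, 1; 1, -2]

/-- Right unimodular matrix of the Smith reduction. -/
def SoloInformed_twistQ (o : ℤ) : Matrix (Fin 2) (Fin 2) ℤ := !![0, 1; 1, -2 * o]

/-- Smith form: `P * M(o) * Q(o) = diag(1, -4o)`, so `coker M(o) ≅ ℤ/4|o|` is cyclic (trivial torsion
iff `o = 0`). -/
theorem SoloInformed_twist_smith (o : ℤ) :
    SoloInformed_twistP * SoloInformed_twistRel o * SoloInformed_twistQ o = !![1, 0; 0, -4 * o] := by
  simp [SoloInformed_twistP, SoloInformed_twistRel, SoloInformed_twistQ]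
  ring_nf

/-- `P` is unimodular. -/
theorem SoloInformed_twistP_det : SoloInformed_twistP.det = -1 := by
  simp [SoloInformed_twistP, Matrix.det_fin_two_of]

/-- `Q(o)` is unimodular. -/
theorem SoloInformed_twistQ_det (o : ℤ) : (SoloInformed_twistQ o).det = -1 := by
  simp [SoloInformed_twistQ, Matrix.det_fin_two_of]

/-- `|det M(o)| = 4|o|`: the torsion of `H₁(∂N(𝕂 ∪ Δ))` has order `4|o|` for `o ≠ 0`. -/
theorem SoloInformed_twistRel_det (o : ℤ) : (SoloInformed_twistRel o).det = -4 * o := by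
  simp [SoloInformed_twistRel, Matrix.det_fin_two_of]
  ring

/-- Independent Kirby-calculus check: the linking block of `(B, γ, h)` (1-handle along `U`, Klein
relator 2-handle, disc 2-handle with `lk(h, γ) = n` and framing `f`) has determinant `4(n - f)`. -/
theorem SoloInformed_twist_kirby_det (n f : ℤ) :
    (!![0, 2, 1; 2, 0, n; 1, n, f] : Matrix (Fin 3) (Fin 3) ℤ).det = 4 * (n - f) := by
  simp [Matrix.det_fin_three]
  ring

/-- Hantzsche's condition cannot be met by a non-trivial cyclic group: a direct double `G × G` of a
non-trivial finite abelian group is not cyclic. -/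
theorem SoloInformed_not_addCyclic_double (G : Type*) [AddCommGroup G] [Finite G] [Nontrivial G] :
    ¬ IsAddCyclic (G × G) := by
  intro hcyc
  obtain ⟨g, hg⟩ := IsAddCyclic.exists_generator (α := G × G)
  have h1 : addOrderOf g = Nat.card (G × G) := addOrderOf_eq_card_of_forall_mem_zmultiples hg
  have h2 : addOrderOf g = (addOrderOf g.1).lcm (addOrderOf g.2) := Prod.addOrderOf g
  have h3 : addOrderOf g.1 ∣ Nat.card G := addOrderOf_dvd_natCard g.1
  have h4 : addOrderOf g.2 ∣ Nat.card G := addOrderOf_dvd_natCard g.2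
  have h5 : (addOrderOf g.1).lcm (addOrderOf g.2) ∣ Nat.card G := Nat.lcm_dvd h3 h4
  have hcard : Nat.card (G × G) = Nat.card G * Nat.card G := Nat.card_prod G G
  have hlt : 1 < Nat.card G := Finite.one_lt_card
  have h6 : Nat.card G * Nat.card G ∣ Nat.card G := by
    rw [← hcard, ← h1, h2]; exact h5
  have h7 : Nat.card G * Nat.card G ≤ Nat.card G :=
    Nat.le_of_dvd (by omega) h6
  nlinarith

/-- The arithmetic conclusion used by LEMMA H: if the torsion order `4|o|` of a cyclic group had to be
that of a direct double it would be `1`; i.e. `4|o| = 1` is impossible and `o = 0` is forced once the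
torsion vanishes.  Stated as: `(-4) * o = 0 ↔ o = 0` and `4 * |o| ≠ 1`. -/
theorem SoloInformed_twist_order (o : ℤ) : ((-4) * o = 0 ↔ o = 0) ∧ 4 * |o| ≠ 1 := by
  constructor
  · omega
  · omega

end Summit.SmoothPoincare4.SmoothPoincare4.Theorems
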